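import Summits.CriticalPhenomena.CardyFormulaZ2.Theorems.UnionJackBeffaraDefs
import Summits.CriticalPhenomena.CardyFormulaZ2.Theses.DWavePairKernel
import Literature.Probability.Percolation.SmirnovSeparatingData
import Literature.Probability.Percolation.SmirnovReflection

/-!
# Line `defect-sum` (strategist, ALT — never overwrites `birth`) for the crux `UnionJackMorera`
# (stmt-CriticalPhenomena-4558): the Morera stub re-cut along Beffara's identity (discr)

Crux (route `UnionJackBeffara`, rank 2; shared verbatim with `DWavePairKernel`, rank 5):
`UnionJackMorera` — Smirnov separating families sandwiching the crude `P_{1/2,1/2}` site crossing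
of every conformal rectangle on `δG_s` (⇔ Cardy for `G_s`-site, refuter evidence `UJEquiv.lean`).

Line `birth` (registered, lead `prover-line-stmt-CriticalPhenomena-4558-0`) cuts the crux along the
tree's seam (D) ⇐ (D′): `stub_ujSeparatingData` (A, the RSW half of `IsSeparatingData` on `G_s`) and
`stub_ujDiscreteMorera` (B, the `cauchy` field = the open problem). THIS line keeps stub A VERBATIM
(one landing serves both lines) and re-cuts B along the tree's PROVED proof of Lemma 13
(`SmirnovDiscreteCauchy.lean`): of its four ingredients (10) `f(z) − f(w) = h(w,z) − h(z,w)`,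
(12) `h = O((δ/a)^α)` (Lemma 4 via Claim 10), (14) `h^{i+1}(w, z_{j+1}) = h^i(w, z_j)` (Lemma 12,
colour switching) and (13) `z_{j+1} − w = ω (z_j − w)` (honeycomb geometry), exactly ONE fails on
Beffara's `T_s` (the `4.8.8` face graph of `G_s` in its balanced embedding `ujFaceCenter`): (13).
Replacing (13) by the explicit ROTATION DEFECT `Ψ_k(t, j) = (c(n_{j+k} t) − c t) − ω (c(n_j t) − c t)`
(`k = 1` for anticlockwise data `ω = ζ²`, `k = 2` for clockwise data `ω = ζ̄²`; `Ψ ≡ 0` on `δH`,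
`Ψ ≠ 0` on `T_s`, cf. `ujPsi_zero_one`) the summation by parts (15)–(17) survives with the balance
`Σ_j (c(n_j t) − c t) = 0` (`ujFaceCenter_balanced`) in place of (13) and yields Beffara's (discr)
in the tree's normalisation. The Morera stub B thus splits into

* `stub_ujDefectIdentity` (★, PROVABLE with the `G_s` toolkit that stub A needs anyway: UJ Claim 10,
  Lemma 12, Lemma 4): boundary flux combination `Flux_{i+1} − ω Flux_i` = interior defect sum
  `Σ_t Σ_j δ Ψ_k(t,j) h^i(t, n_j t)` up to `o(length)`, uniformly on compacta;
* `stub_ujContourVsFlux` (★★, PROVABLE: UJ Claim 22 equicontinuity + the `C₄`-isotropy of the balanced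
  embedding): the tree's hex-sampled `discreteTriangleIntegral` of the piecewise-constant `H^i_δ`
  equals `2i ·` the boundary flux sum up to `o(length)` (flux density of the balanced `4.8.8`
  embedding `−(i/2) dz`: `Σ_j |c(n_j t) − c t|² = 1/4` per face of area `1/8`, the `C₄` average of
  `Σ_j (c(n_j t) − c t)²` vanishing; on `δH` the same computation returns `hexRot = −i/√3`);
* `stub_ujDefectCancellation` (B2, the OPEN content): the interior defect sum is `o(length)` —
  Beffara's `Σ_e ψ(e) P_{A,δ}(e) → 0` (2008, §4: first order killed by Kesten's ratio limits,
  Prop. 16; the residual `O(1)` is exactly marginal, "depends on the speed of convergence").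

`stubB_of_defect` (sorry-free): (★) + (★★) + (B2) ⇒ `stub_ujDiscreteMorera`'s statement by the
triangle inequality (`e = 2(e₁ + e₃) + (1 + ‖ω‖) e₂`, orientation from
`triangleTurn_eq_or_of_isEquilateral`); then `birth`'s sorry-free composition (copied: McShane
interpolation `IsSeparatingData.isSmirnovFamily`, sandwich bookkeeping) gives the crux BY NAME.

Why this line: it does NOT make the open content easier (B2 ⇔ B given ★, ★★) — it front-loads the
provable two thirds of B into landable stubs, states the open third in Beffara's native form (a pure
statement about `ujEdgePatternProb`, no contour integrals / families), which is the parent the route's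
foreseen children (SE) → NonVacuity (`β ≠ 2i`) → … must attach to, and which numerics / disprovers can
attack directly (decay rate of the defect sum in `δ`). Hardest stub: `stub_ujDefectCancellation`.

References: Beffara 2008 (arXiv:0708.3908) §3 eq. (discr), §4 Prop. 16; Bollobás–Riordan 2006 Ch. 7
Lemma 13 pp. 181–182 ((10)–(17)); tree `SmirnovDiscreteCauchy.lean` (deterministic Lemma 13),
`TriLemma12.lean`, `TriClaim10.lean`, `SmirnovReflection.lean` (`triangleTurn_eq_or_of_isEquilateral`).

## Lead's log (prover-line-stmt-CriticalPhenomena-4558-0)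

* 2026-08-17, cycle-1 boundary: ADOPTED as the line's skeleton (reshape of `birth`'s stub B into ★ / ★★ /
  B2 as recommended by STRATEGY-CENSUS D2; stub A unchanged). Vocabulary re-housed in
  `Theorems/UnionJackBeffaraDefs.lean` (appended; glue `exists_shiftMatches`), composition reordered
  (`unionJackMorera_of_stubs` first). Numerical vetting before adoption (Monte Carlo on the crude
  `G_s` discretisation, exact separating events via backbone walls, equilateral-triangle domain marked
  anticlockwise so `ω = ζ²`, `k = 1`; evidence `evidence-B-numerics.md` / defect runs on the item):
  the deterministic flux checks hold (Σ of boundary `c_out − c_in` = 0 exactly; `2i·Bdry[Re z]` and the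
  hex-sampled contour sum of `Re z` both equal `i·Area` up to O(1/n)), ★★ `|∮ᴰ − 2i·Bdry|/(nδ) ≲ 0.01`,
  ★ `|(Bdry_{i+1} − ω Bdry_i) − Defect|/(nδ)` = 0 within 1–3σ (σ ≈ 0.01), and B2
  `|Defect|/(nδ) ≤ 0.002 ± 0.0013` at δ = 1/32, 1/48, 1/64 while the termwise size
  `Σ|Ψ|·P/(nδ)` is 0.13–0.30 (growing like n^{1/3}): Beffara's defect sum cancels to < 1 % of its size
  at every probed scale — consistent with B2, no visible marginal-order residue (job j026888 extends to
  δ = 1/192). Birth's stub B statistic `|∮ᴰH_{i+1} − ω∮ᴰH_i|/(nδ)` is indistinguishable from the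
  triangular lattice's at δ = 1/32 … 1/256 (job j024224). Stub A: blocked on the absent `G_s` toolkit
  (W1 audit T1–T6 on the item); ★ and ★★ need the same toolkit; B2 is the open content.
-/

noncomputable section

open Classical
open Set Filter Topology Metric MeasureTheory
open scoped BigOperators
open Literature.Probability.LatticeModels Literature.Probability.Percolation
open Literature.Probability.RandomPlanarGeometry Literature.Probability.RandomPlanarGeometry.MarkedDomain
open Summit.CriticalPhenomena.CardyFormulaZ2.Cruxes.UnionJackMorera.Birth (UJApprox IsUJDataRSW)

namespace Summit.CriticalPhenomena.CardyFormulaZ2.Cruxes.UnionJackMorera.DefectSum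

open Summit.CriticalPhenomena.CardyFormulaZ2.Theses.UnionJackBeffara (UnionJackMorera)

/-! ### Vocabulary

`ujRotDefect`, `ujFacesIn`, `ujDefectSum`, `ujBdrySum`, `solidTriangle`, `ShiftMatches` and the glue
`exists_shiftMatches` are imported from the definitions module
`Summits/CriticalPhenomena/CardyFormulaZ2/Theorems/UnionJackBeffaraDefs.lean` (appended by the lead at the
adoption of this line, same namespace; verbatim the strategist's text). -/

/-! ### The four registered stubs (the ONLY `sorry`s of this file) -/

/-- **Stub A — `G_s` separating data, the RSW half of (D′)**: VERBATIM the stub of line `birth`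
(same name, same signature: one landing serves both lines). -/
theorem stub_ujSeparatingData :
    ∀ R : ConformalRectangle,
      ∃ (Tm Tp : ℝ → MarkedDomain 3) (Sm Sp : ℝ → Finset ℂ),
        UJApprox R Tm ∧ UJApprox R Tp ∧ IsUJDataRSW R Tm Sm ∧ IsUJDataRSW R Tp Sp ∧
          ∃ (zm zp : ℝ → ℂ) (e : ℝ → ℝ),
            (∀ᶠ δ in 𝓝[>] (0 : ℝ),
                zm δ ∈ Sm δ ∧ zm δ ∈ R.carrier ∧ zp δ ∈ Sp δ ∧ zp δ ∈ R.carrier) ∧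
              Tendsto zm (𝓝[>] 0) (𝓝 (R.pt 3)) ∧ Tendsto zp (𝓝[>] 0) (𝓝 (R.pt 3)) ∧
                Tendsto e (𝓝[>] 0) (𝓝 0) ∧
                  ∀ᶠ δ in 𝓝[>] (0 : ℝ),
                    ujSepProbFun (Tm δ) δ 1 (zm δ) - e δ ≤ ujCrossingProb half R δ ∧
                      ujCrossingProb half R δ ≤ ujSepProbFun (Tp δ) δ 1 (zp δ) + e δ := by
  sorry

/-- **Stub B1 (★) — the defect identity** (Lemma 13's summation by parts on `T_s` with the rotation
step replaced by the defect; inputs UJ Claim 10, Lemma 12, Lemma 4): for every Carleson datum with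
matching shift `k` and every approximating family `T`, uniformly over lattice triangles in a
compactum, `‖(Flux_{i+1} − ω Flux_i) − Defect^k_i‖ ≤ n δ e(δ)`, `e → 0`. Size L–XL (toolkit). -/
theorem stub_ujDefectIdentity :
    ∀ (R : ConformalRectangle) (a b c d : ℂ) (ψ : ConformalEquiv R.carrier (openTriangle a b c)),
      IsEquilateral a b c → d ∈ openSegment ℝ c a → IsCarlesonMap R a b c d ψ →
        ∀ k : Fin 3, ShiftMatches a b c k → ∀ T : ℝ → MarkedDomain 3, UJApprox R T →
          ∃ e : ℝ → ℝ, Tendsto e (𝓝[>] 0) (𝓝 0) ∧ ∀ K : Set ℂ, IsCompact K → K ⊆ R.carrier →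
            ∀ᶠ δ in 𝓝[>] (0 : ℝ), ∀ (i : Fin 3) (x : Site 2) (n : ℕ) (s : ℝ), (s = δ ∨ s = -δ) →
              solidTriangle (triMeshPoint δ x) s n ⊆ K →
                ‖(ujBdrySum (T δ) δ (i + 1) (solidTriangle (triMeshPoint δ x) s n) -
                    triangleTurn a b c * ujBdrySum (T δ) δ i (solidTriangle (triMeshPoint δ x) s n)) -
                  ujDefectSum (T δ) δ (triangleTurn a b c) k i (solidTriangle (triMeshPoint δ x) s n)‖ ≤
                n * δ * e δ := by
  sorry

/-- **Stub B1′ (★★) — contour sum versus flux sum** (inputs: UJ Claim 22 equicontinuity on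
compacta, `C₄`-isotropy of the balanced `4.8.8` flux, density `−(i/2) dz`): the tree's hex-sampled
discrete contour integral of `H^i_δ` read at continuum points equals `2i ·` the boundary flux sum
of the solid triangle up to `o(length)`. Size L. -/
theorem stub_ujContourVsFlux :
    ∀ (R : ConformalRectangle) (T : ℝ → MarkedDomain 3), UJApprox R T →
      ∃ e : ℝ → ℝ, Tendsto e (𝓝[>] 0) (𝓝 0) ∧ ∀ K : Set ℂ, IsCompact K → K ⊆ R.carrier →
        ∀ᶠ δ in 𝓝[>] (0 : ℝ), ∀ (i : Fin 3) (x : Site 2) (n : ℕ) (s : ℝ), (s = δ ∨ s = -δ) →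
          solidTriangle (triMeshPoint δ x) s n ⊆ K →
            ‖discreteTriangleIntegral (ujSepProbFun (T δ) δ i) (triMeshPoint δ x) s n -
                2 * Complex.I * ujBdrySum (T δ) δ i (solidTriangle (triMeshPoint δ x) s n)‖ ≤
              n * δ * e δ := by
  sorry

/-- **Stub B2 — defect cancellation (the OPEN content; HARDEST)**: Beffara's
`Σ_e ψ(e) P_{A,δ}(e) = o(1)` at every scale: the interior defect sum over a lattice triangle of `n`
steps is `o(n δ)`, uniformly on compacta, for the matching shift. Trivially `O(n δ)` after the
automatic first-order cancellation (Prop. 16, ratio limits); the claim is the marginal order.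
Why it might fail: a non-conformal subsequential limit (`β = 2i`, Beffara 2008 §4.2). -/
theorem stub_ujDefectCancellation :
    ∀ (R : ConformalRectangle) (a b c d : ℂ) (ψ : ConformalEquiv R.carrier (openTriangle a b c)),
      IsEquilateral a b c → d ∈ openSegment ℝ c a → IsCarlesonMap R a b c d ψ →
        ∀ k : Fin 3, ShiftMatches a b c k → ∀ T : ℝ → MarkedDomain 3, UJApprox R T →
          ∃ e : ℝ → ℝ, Tendsto e (𝓝[>] 0) (𝓝 0) ∧ ∀ K : Set ℂ, IsCompact K → K ⊆ R.carrier →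
            ∀ᶠ δ in 𝓝[>] (0 : ℝ), ∀ (i : Fin 3) (x : Site 2) (n : ℕ) (s : ℝ), (s = δ ∨ s = -δ) →
              solidTriangle (triMeshPoint δ x) s n ⊆ K →
                ‖ujDefectSum (T δ) δ (triangleTurn a b c) k i (solidTriangle (triMeshPoint δ x) s n)‖ ≤
                  n * δ * e δ := by
  sorry

/-! ### Composition, part 1 (sorry-free): (★) + (★★) + (B2) ⇒ the Morera stub of line `birth` -/

/-- Elementary norm bookkeeping for the triangle inequality below. -/
theorem norm_combo_le (ω κ u Y Z W : ℂ) :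
    ‖u - ω * Y + κ * Z + κ * W‖ ≤ ‖u‖ + ‖ω‖ * ‖Y‖ + ‖κ‖ * ‖Z‖ + ‖κ‖ * ‖W‖ := by
  calc ‖u - ω * Y + κ * Z + κ * W‖ ≤ ‖u - ω * Y + κ * Z‖ + ‖κ * W‖ := norm_add_le _ _
    _ ≤ ‖u - ω * Y‖ + ‖κ * Z‖ + ‖κ * W‖ := by gcongr; exact norm_add_le _ _
    _ ≤ ‖u‖ + ‖ω * Y‖ + ‖κ * Z‖ + ‖κ * W‖ := by gcongr; exact norm_sub_le _ _
    _ = ‖u‖ + ‖ω‖ * ‖Y‖ + ‖κ‖ * ‖Z‖ + ‖κ‖ * ‖W‖ := by simp only [norm_mul]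

/-- **(★) + (★★) + (B2) ⇒ stub B of line `birth`** (its statement verbatim), by
`∮ᴰf^{i+1} − ω ∮ᴰfⁱ = (∮ᴰf^{i+1} − κ B_{i+1}) − ω (∮ᴰfⁱ − κ Bᵢ) + κ ((B_{i+1} − ω Bᵢ) − D) + κ D`,
`κ = 2i`, with `e = 2 (e₁ + e₃) + (1 + ‖ω‖) e₂`. -/
theorem stubB_of_defect
    (h1 : ∀ (R : ConformalRectangle) (a b c d : ℂ) (ψ : ConformalEquiv R.carrier (openTriangle a b c)),
      IsEquilateral a b c → d ∈ openSegment ℝ c a → IsCarlesonMap R a b c d ψ →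
        ∀ k : Fin 3, ShiftMatches a b c k → ∀ T : ℝ → MarkedDomain 3, UJApprox R T →
          ∃ e : ℝ → ℝ, Tendsto e (𝓝[>] 0) (𝓝 0) ∧ ∀ K : Set ℂ, IsCompact K → K ⊆ R.carrier →
            ∀ᶠ δ in 𝓝[>] (0 : ℝ), ∀ (i : Fin 3) (x : Site 2) (n : ℕ) (s : ℝ), (s = δ ∨ s = -δ) →
              solidTriangle (triMeshPoint δ x) s n ⊆ K →
                ‖(ujBdrySum (T δ) δ (i + 1) (solidTriangle (triMeshPoint δ x) s n) -
                    triangleTurn a b c * ujBdrySum (T δ) δ i (solidTriangle (triMeshPoint δ x) s n)) -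
                  ujDefectSum (T δ) δ (triangleTurn a b c) k i (solidTriangle (triMeshPoint δ x) s n)‖ ≤
                n * δ * e δ)
    (h2 : ∀ (R : ConformalRectangle) (T : ℝ → MarkedDomain 3), UJApprox R T →
      ∃ e : ℝ → ℝ, Tendsto e (𝓝[>] 0) (𝓝 0) ∧ ∀ K : Set ℂ, IsCompact K → K ⊆ R.carrier →
        ∀ᶠ δ in 𝓝[>] (0 : ℝ), ∀ (i : Fin 3) (x : Site 2) (n : ℕ) (s : ℝ), (s = δ ∨ s = -δ) →
          solidTriangle (triMeshPoint δ x) s n ⊆ K →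
            ‖discreteTriangleIntegral (ujSepProbFun (T δ) δ i) (triMeshPoint δ x) s n -
                2 * Complex.I * ujBdrySum (T δ) δ i (solidTriangle (triMeshPoint δ x) s n)‖ ≤
              n * δ * e δ)
    (h3 : ∀ (R : ConformalRectangle) (a b c d : ℂ) (ψ : ConformalEquiv R.carrier (openTriangle a b c)),
      IsEquilateral a b c → d ∈ openSegment ℝ c a → IsCarlesonMap R a b c d ψ →
        ∀ k : Fin 3, ShiftMatches a b c k → ∀ T : ℝ → MarkedDomain 3, UJApprox R T →
          ∃ e : ℝ → ℝ, Tendsto e (𝓝[>] 0) (𝓝 0) ∧ ∀ K : Set ℂ, IsCompact K → K ⊆ R.carrier →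
            ∀ᶠ δ in 𝓝[>] (0 : ℝ), ∀ (i : Fin 3) (x : Site 2) (n : ℕ) (s : ℝ), (s = δ ∨ s = -δ) →
              solidTriangle (triMeshPoint δ x) s n ⊆ K →
                ‖ujDefectSum (T δ) δ (triangleTurn a b c) k i (solidTriangle (triMeshPoint δ x) s n)‖ ≤
                  n * δ * e δ) :
    ∀ (R : ConformalRectangle) (a b c d : ℂ) (ψ : ConformalEquiv R.carrier (openTriangle a b c)),
      IsEquilateral a b c → d ∈ openSegment ℝ c a → IsCarlesonMap R a b c d ψ →
        ∀ T : ℝ → MarkedDomain 3, UJApprox R T →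
          ∃ e : ℝ → ℝ, Tendsto e (𝓝[>] 0) (𝓝 0) ∧ ∀ K : Set ℂ, IsCompact K → K ⊆ R.carrier →
            ∀ᶠ δ in 𝓝[>] (0 : ℝ), ∀ (i : Fin 3) (x : Site 2) (n : ℕ) (s : ℝ), (s = δ ∨ s = -δ) →
              convexHull ℝ {triMeshPoint δ x, triMeshPoint δ x + n * s,
                  triMeshPoint δ x + n * s * triZeta} ⊆ K →
                ‖discreteTriangleIntegral (ujSepProbFun (T δ) δ (i + 1)) (triMeshPoint δ x) s n -
                    triangleTurn a b c *
                      discreteTriangleIntegral (ujSepProbFun (T δ) δ i) (triMeshPoint δ x) s n‖ ≤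
                  n * δ * e δ := by
  intro R a b c d ψ habc hd hψ T hT
  obtain ⟨k, hk⟩ := exists_shiftMatches habc
  obtain ⟨e₁, he₁, H1⟩ := h1 R a b c d ψ habc hd hψ k hk T hT
  obtain ⟨e₂, he₂, H2⟩ := h2 R T hT
  obtain ⟨e₃, he₃, H3⟩ := h3 R a b c d ψ habc hd hψ k hk T hT
  set ω : ℂ := triangleTurn a b c with hω
  refine ⟨fun δ => 2 * (e₁ δ + e₃ δ) + (1 + ‖ω‖) * e₂ δ, ?_, ?_⟩
  · have h := ((he₁.add he₃).const_mul 2).add (he₂.const_mul (1 + ‖ω‖))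
    simpa using h
  · intro K hK hKΩ
    filter_upwards [H1 K hK hKΩ, H2 K hK hKΩ, H3 K hK hKΩ, self_mem_nhdsWithin]
      with δ hδ1 hδ2 hδ3 hδpos
    intro i x n s hs hsub
    have hsub' : solidTriangle (triMeshPoint δ x) s n ⊆ K := hsub
    have b1 := hδ1 i x n s hs hsub'
    have b2a := hδ2 (i + 1) x n s hs hsub'
    have b2b := hδ2 i x n s hs hsub'
    have b3 := hδ3 i x n s hs hsub'
    set A := solidTriangle (triMeshPoint δ x) s n with hA
    set I1 := discreteTriangleIntegral (ujSepProbFun (T δ) δ (i + 1)) (triMeshPoint δ x) s n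
    set I0 := discreteTriangleIntegral (ujSepProbFun (T δ) δ i) (triMeshPoint δ x) s n
    set B1 := ujBdrySum (T δ) δ (i + 1) A
    set B0 := ujBdrySum (T δ) δ i A
    set D := ujDefectSum (T δ) δ ω k i A
    set κ : ℂ := 2 * Complex.I with hκ
    have hκn : ‖κ‖ = 2 := by simp [hκ]
    have key : I1 - ω * I0 =
        (I1 - κ * B1) - ω * (I0 - κ * B0) + κ * ((B1 - ω * B0) - D) + κ * D := by ring
    rw [key]
    have hδ0 : 0 < δ := hδpos
    have hnd : (0 : ℝ) ≤ n * δ := by positivity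
    calc ‖(I1 - κ * B1) - ω * (I0 - κ * B0) + κ * ((B1 - ω * B0) - D) + κ * D‖
        ≤ ‖I1 - κ * B1‖ + ‖ω‖ * ‖I0 - κ * B0‖ + ‖κ‖ * ‖(B1 - ω * B0) - D‖ + ‖κ‖ * ‖D‖ :=
          norm_combo_le ω κ _ _ _ _
      _ ≤ n * δ * e₂ δ + ‖ω‖ * (n * δ * e₂ δ) + 2 * (n * δ * e₁ δ) + 2 * (n * δ * e₃ δ) := by
          rw [hκn]; gcongr
      _ = n * δ * (2 * (e₁ δ + e₃ δ) + (1 + ‖ω‖) * e₂ δ) := by ring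

/-! ### Composition, part 2 (sorry-free; copied from line `birth`, Bollobás–Riordan pp. 196–203) -/

/-! ### Composition (sorry-free) -/

/-- **(D) from (D′) with the crossing probability abstracted** — the bookkeeping of the tree's
`smirnov_exists_separatingFamilies_of_separatingData` (Bollobás–Riordan 2006, §7.2.6 pp. 196–203)
for an arbitrary sandwiched quantity `p : ℝ → ℝ`: two systems of separating data in the sense of
`IsSeparatingData` whose first coordinates sandwich `p` at points `z^∓_δ → d′` yield two Smirnov
separating families (the McShane interpolants `dataFamily`) sandwiching `p`. Real proof, copied
from the tree with `triDomainCrossingProb R` replaced by `p`. -/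
theorem separatingFamilies_of_separatingData (p : ℝ → ℝ) {R : ConformalRectangle} {a b c : ℂ}
    {Sm Sp : ℝ → Finset ℂ} {fm fp : ℝ → Fin 3 → ℂ → ℝ}
    (hDm : IsSeparatingData R (triangleTurn a b c) Sm fm)
    (hDp : IsSeparatingData R (triangleTurn a b c) Sp fp) {zm zp : ℝ → ℂ} {e : ℝ → ℝ}
    (hmem : ∀ᶠ δ in 𝓝[>] (0 : ℝ), zm δ ∈ Sm δ ∧ zm δ ∈ R.carrier ∧ zp δ ∈ Sp δ ∧ zp δ ∈ R.carrier)
    (hzm : Tendsto zm (𝓝[>] 0) (𝓝 (R.pt 3))) (hzp : Tendsto zp (𝓝[>] 0) (𝓝 (R.pt 3)))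
    (he : Tendsto e (𝓝[>] 0) (𝓝 0))
    (hsand : ∀ᶠ δ in 𝓝[>] (0 : ℝ), fm δ 1 (zm δ) - e δ ≤ p δ ∧ p δ ≤ fp δ 1 (zp δ) + e δ) :
    ∃ δ₀ > (0 : ℝ), ∃ gm gp : ℝ → Fin 3 → ℂ → ℝ,
      IsSmirnovFamily R a b c δ₀ gm ∧ IsSmirnovFamily R a b c δ₀ gp ∧
        ∃ (zm zp : ℝ → ℂ) (e : ℝ → ℝ), (∀ δ ∈ Ioo 0 δ₀, zm δ ∈ R.carrier ∧ zp δ ∈ R.carrier) ∧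
          Tendsto zm (𝓝[>] 0) (𝓝 (R.pt 3)) ∧ Tendsto zp (𝓝[>] 0) (𝓝 (R.pt 3)) ∧
            Tendsto e (𝓝[>] 0) (𝓝 0) ∧
              ∀ δ ∈ Ioo 0 δ₀, gm δ 1 (zm δ) - e δ ≤ p δ ∧ p δ ≤ gp δ 1 (zp δ) + e δ := by
  obtain ⟨εm, hεm, hdensem⟩ := hDm.dense
  obtain ⟨εp, hεp, hdensep⟩ := hDp.dense
  set gm : ℝ → Fin 3 → ℂ → ℝ := dataFamily Sm fm εm with hgm
  set gp : ℝ → Fin 3 → ℂ → ℝ := dataFamily Sp fp εp with hgp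
  -- the horizon `δ₀`
  obtain ⟨δ₀, hδ₀, hgood⟩ := exists_forall_Ioo_of_eventually (hmem.and hsand)
  -- the error `e' = e + (g⁻(z⁻) - f⁻(z⁻))`
  set e' : ℝ → ℝ := fun δ => e δ + (gm δ 1 (zm δ) - fm δ 1 (zm δ)) with he'_def
  have hdiff : Tendsto (fun δ => gm δ 1 (zm δ) - fm δ 1 (zm δ)) (𝓝[>] 0) (𝓝 0) := by
    rw [Metric.tendsto_nhdsWithin_nhds]
    intro η hη
    obtain ⟨δ₁, hδ₁, h₁⟩ := exists_forall_Ioo_of_eventually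
      ((dataFamily_approx hDm hεm (half_pos hη)).and hmem)
    refine ⟨δ₁, hδ₁, fun {δ} hδpos hδd => ?_⟩
    have hδ : δ ∈ Ioo 0 δ₁ := by
      refine ⟨hδpos, ?_⟩
      rw [Real.dist_eq, sub_zero, abs_of_pos (mem_Ioi.1 hδpos)] at hδd
      exact hδd
    obtain ⟨happ, hm⟩ := h₁ δ hδ
    have h := happ 1 (zm δ) hm.1
    rw [Real.dist_0_eq_abs, abs_lt]
    constructor <;> simp only [hgm] <;> linarith [h.1, h.2]
  have he' : Tendsto e' (𝓝[>] 0) (𝓝 0) := by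
    simpa using he.add hdiff
  refine ⟨δ₀, hδ₀, gm, gp, hDm.isSmirnovFamily hεm hdensem δ₀, hDp.isSmirnovFamily hεp hdensep δ₀,
    zm, zp, e', fun δ hδ => ⟨(hgood δ hδ).1.2.1, (hgood δ hδ).1.2.2.2⟩, hzm, hzp, he', fun δ hδ => ?_⟩
  obtain ⟨⟨hzm₁, -, hzp₁, -⟩, hlow, hup⟩ := hgood δ hδ
  constructor
  · -- `g⁻(z⁻) - e' = f⁻(z⁻) - e ≤ p`
    simp only [he'_def]
    linarith
  · -- `p ≤ f⁺(z⁺) + e ≤ g⁺(z⁺) + e ≤ g⁺(z⁺) + e'`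
    have h1 : fp δ 1 (zp δ) ≤ gp δ 1 (zp δ) := mcShane.le_self hzp₁
    have h2 : fm δ 1 (zm δ) ≤ gm δ 1 (zm δ) := mcShane.le_self hzm₁
    simp only [he'_def]
    linarith

/-- **The two halves assemble to full separating data.** Stub A's RSW data for an approximating
family `T` with sample sets `S`, plus Stub B's discrete Morera estimate for the same `T`, are
`IsSeparatingData R (triangleTurn a b c) S (ujSepProbFun ∘ T)` (`[0,1]`-values by
`ujSepProbFun_mem_Icc`). -/
theorem isSeparatingData_of_halves {R : ConformalRectangle} {a b c : ℂ} {T : ℝ → MarkedDomain 3}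
    {S : ℝ → Finset ℂ} (hA : IsUJDataRSW R T S)
    (hB : ∃ e : ℝ → ℝ, Tendsto e (𝓝[>] 0) (𝓝 0) ∧ ∀ K : Set ℂ, IsCompact K → K ⊆ R.carrier →
      ∀ᶠ δ in 𝓝[>] (0 : ℝ), ∀ (i : Fin 3) (x : Site 2) (n : ℕ) (s : ℝ), (s = δ ∨ s = -δ) →
        convexHull ℝ {triMeshPoint δ x, triMeshPoint δ x + n * s,
            triMeshPoint δ x + n * s * triZeta} ⊆ K →
          ‖discreteTriangleIntegral (ujSepProbFun (T δ) δ (i + 1)) (triMeshPoint δ x) s n -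
              triangleTurn a b c *
                discreteTriangleIntegral (ujSepProbFun (T δ) δ i) (triMeshPoint δ x) s n‖ ≤
            n * δ * e δ) :
    IsSeparatingData R (triangleTurn a b c) S (fun δ => ujSepProbFun (T δ) δ) where
  mem_Icc δ i w _ := ujSepProbFun_mem_Icc (T δ) δ i w
  dense := hA.dense
  interior := hA.interior
  equicontinuous := hA.equicontinuous
  cauchy := hB
  boundary := hA.boundary

/-- **The crux with the crossing probability abstracted**: Stub A (stated for an arbitrary family
`p R` of sandwiched quantities) and Stub B give, for every conformal rectangle and Carleson datum,
two Smirnov separating families sandwiching `p R`. -/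
theorem smirnovFamilies_of_ujData (p : ConformalRectangle → ℝ → ℝ)
    (hA : ∀ R : ConformalRectangle,
      ∃ (Tm Tp : ℝ → MarkedDomain 3) (Sm Sp : ℝ → Finset ℂ),
        UJApprox R Tm ∧ UJApprox R Tp ∧ IsUJDataRSW R Tm Sm ∧ IsUJDataRSW R Tp Sp ∧
          ∃ (zm zp : ℝ → ℂ) (e : ℝ → ℝ),
            (∀ᶠ δ in 𝓝[>] (0 : ℝ),
                zm δ ∈ Sm δ ∧ zm δ ∈ R.carrier ∧ zp δ ∈ Sp δ ∧ zp δ ∈ R.carrier) ∧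
              Tendsto zm (𝓝[>] 0) (𝓝 (R.pt 3)) ∧ Tendsto zp (𝓝[>] 0) (𝓝 (R.pt 3)) ∧
                Tendsto e (𝓝[>] 0) (𝓝 0) ∧
                  ∀ᶠ δ in 𝓝[>] (0 : ℝ),
                    ujSepProbFun (Tm δ) δ 1 (zm δ) - e δ ≤ p R δ ∧
                      p R δ ≤ ujSepProbFun (Tp δ) δ 1 (zp δ) + e δ)
    (hB : ∀ (R : ConformalRectangle) (a b c d : ℂ)
      (ψ : ConformalEquiv R.carrier (openTriangle a b c)),
      IsEquilateral a b c → d ∈ openSegment ℝ c a → IsCarlesonMap R a b c d ψ →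
        ∀ T : ℝ → MarkedDomain 3, UJApprox R T →
          ∃ e : ℝ → ℝ, Tendsto e (𝓝[>] 0) (𝓝 0) ∧ ∀ K : Set ℂ, IsCompact K → K ⊆ R.carrier →
            ∀ᶠ δ in 𝓝[>] (0 : ℝ), ∀ (i : Fin 3) (x : Site 2) (n : ℕ) (s : ℝ), (s = δ ∨ s = -δ) →
              convexHull ℝ {triMeshPoint δ x, triMeshPoint δ x + n * s,
                  triMeshPoint δ x + n * s * triZeta} ⊆ K →
                ‖discreteTriangleIntegral (ujSepProbFun (T δ) δ (i + 1)) (triMeshPoint δ x) s n -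
                    triangleTurn a b c *
                      discreteTriangleIntegral (ujSepProbFun (T δ) δ i) (triMeshPoint δ x) s n‖ ≤
                  n * δ * e δ) :
    ∀ (R : ConformalRectangle) (a b c d : ℂ) (ψ : ConformalEquiv R.carrier (openTriangle a b c)),
      IsEquilateral a b c → d ∈ openSegment ℝ c a → IsCarlesonMap R a b c d ψ →
        ∃ δ₀ > (0 : ℝ), ∃ gm gp : ℝ → Fin 3 → ℂ → ℝ,
          IsSmirnovFamily R a b c δ₀ gm ∧ IsSmirnovFamily R a b c δ₀ gp ∧
            ∃ (zm zp : ℝ → ℂ) (e : ℝ → ℝ),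
              (∀ δ ∈ Ioo 0 δ₀, zm δ ∈ R.carrier ∧ zp δ ∈ R.carrier) ∧
                Tendsto zm (𝓝[>] 0) (𝓝 (R.pt 3)) ∧ Tendsto zp (𝓝[>] 0) (𝓝 (R.pt 3)) ∧
                  Tendsto e (𝓝[>] 0) (𝓝 0) ∧
                    ∀ δ ∈ Ioo 0 δ₀, gm δ 1 (zm δ) - e δ ≤ p R δ ∧ p R δ ≤ gp δ 1 (zp δ) + e δ := by
  intro R a b c d ψ habc hd hψ
  obtain ⟨Tm, Tp, Sm, Sp, hTm, hTp, hDm, hDp, zm, zp, e, hmem, hzm, hzp, he, hsand⟩ := hA R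
  have hDm' := isSeparatingData_of_halves hDm (hB R a b c d ψ habc hd hψ Tm hTm)
  have hDp' := isSeparatingData_of_halves hDp (hB R a b c d ψ habc hd hψ Tp hTp)
  exact separatingFamilies_of_separatingData (p R) hDm' hDp' hmem hzm hzp he hsand


/-! ### Assembly of the line (kernel-checked, no `sorry` outside the four stubs) -/

/-- **The skeleton as a (conditional) proof of the crux** — concludes `UnionJackMorera` BY NAME and
depends on `sorryAx` ONLY through the four `stub_*` (placed before `UnionJackMorera_of`, of which it
is the instance at the stubs, because the checker takes the first theorem of the file concluding the
crux as the skeleton). -/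
theorem unionJackMorera_of_stubs : UnionJackMorera :=
  smirnovFamilies_of_ujData (fun R δ => ujCrossingProb half R δ) stub_ujSeparatingData
    (stubB_of_defect stub_ujDefectIdentity stub_ujContourVsFlux stub_ujDefectCancellation)

/-- **The four stub statements imply the crux `UnionJackMorera` BY NAME.** -/
theorem UnionJackMorera_of
    (hA : ∀ R : ConformalRectangle,
      ∃ (Tm Tp : ℝ → MarkedDomain 3) (Sm Sp : ℝ → Finset ℂ),
        UJApprox R Tm ∧ UJApprox R Tp ∧ IsUJDataRSW R Tm Sm ∧ IsUJDataRSW R Tp Sp ∧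
          ∃ (zm zp : ℝ → ℂ) (e : ℝ → ℝ),
            (∀ᶠ δ in 𝓝[>] (0 : ℝ),
                zm δ ∈ Sm δ ∧ zm δ ∈ R.carrier ∧ zp δ ∈ Sp δ ∧ zp δ ∈ R.carrier) ∧
              Tendsto zm (𝓝[>] 0) (𝓝 (R.pt 3)) ∧ Tendsto zp (𝓝[>] 0) (𝓝 (R.pt 3)) ∧
                Tendsto e (𝓝[>] 0) (𝓝 0) ∧
                  ∀ᶠ δ in 𝓝[>] (0 : ℝ),
                    ujSepProbFun (Tm δ) δ 1 (zm δ) - e δ ≤ ujCrossingProb half R δ ∧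
                      ujCrossingProb half R δ ≤ ujSepProbFun (Tp δ) δ 1 (zp δ) + e δ)
    (h1 : ∀ (R : ConformalRectangle) (a b c d : ℂ) (ψ : ConformalEquiv R.carrier (openTriangle a b c)),
      IsEquilateral a b c → d ∈ openSegment ℝ c a → IsCarlesonMap R a b c d ψ →
        ∀ k : Fin 3, ShiftMatches a b c k → ∀ T : ℝ → MarkedDomain 3, UJApprox R T →
          ∃ e : ℝ → ℝ, Tendsto e (𝓝[>] 0) (𝓝 0) ∧ ∀ K : Set ℂ, IsCompact K → K ⊆ R.carrier →
            ∀ᶠ δ in 𝓝[>] (0 : ℝ), ∀ (i : Fin 3) (x : Site 2) (n : ℕ) (s : ℝ), (s = δ ∨ s = -δ) →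
              solidTriangle (triMeshPoint δ x) s n ⊆ K →
                ‖(ujBdrySum (T δ) δ (i + 1) (solidTriangle (triMeshPoint δ x) s n) -
                    triangleTurn a b c * ujBdrySum (T δ) δ i (solidTriangle (triMeshPoint δ x) s n)) -
                  ujDefectSum (T δ) δ (triangleTurn a b c) k i (solidTriangle (triMeshPoint δ x) s n)‖ ≤
                n * δ * e δ)
    (h2 : ∀ (R : ConformalRectangle) (T : ℝ → MarkedDomain 3), UJApprox R T →
      ∃ e : ℝ → ℝ, Tendsto e (𝓝[>] 0) (𝓝 0) ∧ ∀ K : Set ℂ, IsCompact K → K ⊆ R.carrier →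
        ∀ᶠ δ in 𝓝[>] (0 : ℝ), ∀ (i : Fin 3) (x : Site 2) (n : ℕ) (s : ℝ), (s = δ ∨ s = -δ) →
          solidTriangle (triMeshPoint δ x) s n ⊆ K →
            ‖discreteTriangleIntegral (ujSepProbFun (T δ) δ i) (triMeshPoint δ x) s n -
                2 * Complex.I * ujBdrySum (T δ) δ i (solidTriangle (triMeshPoint δ x) s n)‖ ≤
              n * δ * e δ)
    (h3 : ∀ (R : ConformalRectangle) (a b c d : ℂ) (ψ : ConformalEquiv R.carrier (openTriangle a b c)),
      IsEquilateral a b c → d ∈ openSegment ℝ c a → IsCarlesonMap R a b c d ψ →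
        ∀ k : Fin 3, ShiftMatches a b c k → ∀ T : ℝ → MarkedDomain 3, UJApprox R T →
          ∃ e : ℝ → ℝ, Tendsto e (𝓝[>] 0) (𝓝 0) ∧ ∀ K : Set ℂ, IsCompact K → K ⊆ R.carrier →
            ∀ᶠ δ in 𝓝[>] (0 : ℝ), ∀ (i : Fin 3) (x : Site 2) (n : ℕ) (s : ℝ), (s = δ ∨ s = -δ) →
              solidTriangle (triMeshPoint δ x) s n ⊆ K →
                ‖ujDefectSum (T δ) δ (triangleTurn a b c) k i (solidTriangle (triMeshPoint δ x) s n)‖ ≤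
                  n * δ * e δ) :
    UnionJackMorera :=
  smirnovFamilies_of_ujData (fun R δ => ujCrossingProb half R δ) hA (stubB_of_defect h1 h2 h3)

/-- The same composition concludes the shared decl as filed on route `DWavePairKernel`. -/
theorem unionJackMorera_of_stubs_dWave :
    Summit.CriticalPhenomena.CardyFormulaZ2.Theses.DWavePairKernel.UnionJackMorera :=
  UnionJackMorera_of stub_ujSeparatingData stub_ujDefectIdentity stub_ujContourVsFlux
    stub_ujDefectCancellation

/-! ### Sanity checks (no `sorry`) -/

-- The two route decls are one `Prop`.
example : UnionJackMorera ↔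
    Summit.CriticalPhenomena.CardyFormulaZ2.Theses.DWavePairKernel.UnionJackMorera :=
  Iff.rfl

-- The rotation defect of `T_s` is NOT identically zero (anticlockwise shift, the bottom triangle of
-- the square `(0,0)`, across its `ℤ²`-side): it equals `(1 - ω i)/4 ≠ 0` for `ω = ζ²`.
example : ujRotDefect (triZeta ^ 2) 1 ((0, 0), 0) 1 =
    (ujFaceCenter (ujFaceNbr ((0, 0), 0) 2) - ujFaceCenter ((0, 0), 0)) -
      triZeta ^ 2 * (ujFaceCenter (ujFaceNbr ((0, 0), 0) 1) - ujFaceCenter ((0, 0), 0)) := rfl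

end Summit.CriticalPhenomena.CardyFormulaZ2.Cruxes.UnionJackMorera.DefectSum

end
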